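import Summits.NavierStokesRegularity.NavierStokesRegularity.Theorems.ScenarioCensusRowF1WhirlTopFloors
import HarnessLib

/-!
# LINE 42 «whirl-top» port, part 4/4: §6 residual `WhirlCollapse` ≡ `Row_F1` (`whirlLevel_spec`, `rowF1_of_whirlCollapse`, `whirlCollapse_iff_rowF1`), what the hypotheses admit (swirling
# columns, streams, the rest state, pitch-zero comparison with LINE 41); §7 summary; census KEYS `Row_F1gx` / `Row_F1wx` / `Row_F1qx` / `Row_F1px` + `_excluded`, floors WF / PF

Re-homed for the scenario census (typer seat ns-census-typer-1 g10; the cells F1gx / F1wx / F1qx / F1px and the floors WF / PF are members of row F1 «DECIDED IN KERNEL IN FILES» (LINE 42: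
ref ns-census-ref g15 PRE-CHECK ✓ §20.19, critic idea-crit-3 g10 PASS no price tier B 14:05:49Z, lead booking CANDIDATE 3/4 at v1.124 → of record with the critic's PASS); this port
makes them TREE-decided): VERBATIM PORT of ns-idea-3 LINE 42 «whirl-top», `pub/ideators/ns-idea-3/lines/whirl-top/line-whirl-top.lean` sha16 b777a0715a2eb784 (1320 l., lean check rc 0,
0 sorry), split for the 400-line rule into `ScenarioCensusRowF1WhirlTop` (§1–§4a) → `…WhirlTopKill` (§4b) → `…WhirlTopFloors` (§5) → `…WhirlTopRows` (§6–§7 + census KEYS).  Lean text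
VERBATIM in namespace `…Theorems.ScenarioCensus.WhirlTop` (the line's `…Cruxes.ScenarioCensusRowF1.WhirlTopLine` re-homed); port edits: the frame restated VERBATIM by the line from LINES
34–41 (`topSet`, `HasTypeIConstant`, `snapLevel`, `exists_fast_at`, `sqrt_mul_sq_mul`, `limitClass_compact`, `exists_level_of_limitKill`, `exists_witnessZoom_package`, `zoom_units`,
`eventually_forall_not_of_not_frequently`, `continuous_slice'`, `tendsto_eval`, `le_of_units`, `row_of_floor`, `rotLin`, `rotCLM`, `coe_rotCLM`, `analyticAt_rotZ`, `analyticAt_transport`, `rotZ_smul_eZ'`, `stream_fast`)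
is taken BY NAME from the landed two-time-top / one-level-top / snapshot-top / needle-top / echo-top / scaling-top / screw-top ports; elementary lemmas the line restates are the tree's BY
NAME (`rotZ_add_vec'` = `ScrewBlowdown.rotZ_add_vec`, `rotZ_add_smul_eZ'` = `ScrewBlowdown.rotZ_add_smul_eZ`, `rotZ_smul_vec'` = `rotZ_smul`, `rotZ_neg_rotZ'` = `rotZ_neg_apply_rotZ`,
`continuous_rotZ`, `continuous_rotZ_angle'` = `continuous_rotZ_angle`, `centre_mem` = `IsTypeIAncientMild.comp_add_right` (Literature.Analysis.FluidPDE), `rotZ_two_pi'` =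
`RotationOrder.rotZ_two_pi` (census rotation-order port), `addSubgroup_eq_univ_of_irrational_angle` / `forall_of_irrational_angle` = `SymmetricScarExists.RdssSplit.NearIdentity.…` — the
line's own header names the latter two as clones); `analyticAt_linIso` and `tendstoLocallyUniformly_comp_of_tendsto` (twins of lemmas in route-cone modules that are not imported) are not
re-declared — the former's one-line proof term is inlined; `@[conjecture]` on the residual `WhirlCollapse` (≡ `ScenarioCensus.Row_F1`, OPEN); one-line docstrings added where missing (gate
lint).  Statements untouched.

No census VALUE is moved here (row F1 stays OPEN-WITH-LINE; the members become TREE-decided by name); NS regularity is NOT proved; `Row_F1` is untouched (zero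
movement, `whirlCollapse_iff_rowF1`); no summit statement is proved by this file. Lemmas that restate already-landed tree declarations are taken BY NAME (gate lint `dedup.landed`): `topSet` = `TwoTimeTop.topSet`, `HasTypeIConstant` = `OneLevelTop.HasTypeIConstant`, `snapLevel` = `SnapshotTop.snapLevel`, `exists_fast_at` = `SnapshotTop.exists_fast_at`, `sqrt_mul_sq_mul` = `SnapshotTop.sqrt_mul_sq_mul`, `limitClass_compact` = `NeedleTop.limitClass_compact`, `exists_level_of_limitKill` = `NeedleTop.exists_level_of_limitKill`, `zoom_units` = `NeedleTop.zoom_units`, `exists_witnessZoom_package` = `EchoTop.exists_witnessZoom_package`, `eventually_forall_not_of_not_frequently` = `EchoTop.eventually_forall_not_of_not_frequently`, `centre_mem` = `IsTypeIAncientMild.comp_add_right`, `continuous_slice'` = `ScalingTop.continuous_slice'`, `tendsto_eval` = `ScalingTop.tendsto_eval`, `le_of_units` = `ScalingTop.le_of_units`, `rotZ_add_vec'` = `ScrewBlowdown.rotZ_add_vec`, `rotZ_smul_vec'` = `rotZ_smul`, `rotZ_add_smul_eZ'` = `ScrewBlowdown.rotZ_add_smul_eZ`, `rotLin` = `ScrewTop.rotLin`,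 `rotCLM` = `ScrewTop.rotCLM`, `analyticAt_rotZ` = `ScrewTop.analyticAt_rotZ`, `rotZ_neg_rotZ'` = `rotZ_neg_apply_rotZ`, `rotZ_two_pi'` = `RotationOrder.rotZ_two_pi`, `continuous_rotZ_angle'` = `continuous_rotZ_angle`, `addSubgroup_eq_univ_of_irrational_angle` = `SymmetricScarExists.RdssSplit.NearIdentity.addSubgroup_eq_top_of_irrational_angle`, `forall_of_irrational_angle` = `SymmetricScarExists.RdssSplit.NearIdentity.forall_of_irrational_angle_stabiliser`, `analyticAt_transport` = `ScrewTop.analyticAt_transport`, `rotZ_smul_eZ'` = `ScrewTop.rotZ_smul_eZ'`, `row_of_floor` = `ScalingTop.row_of_floor`, `stream_fast` = `ScrewTop.stream_fast`.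
-/

-- the summit and its single problem share the name `NavierStokesRegularity` (D-0017 nested layout)
set_option linter.dupNamespace false

noncomputable section

open MeasureTheory Set Function Filter TopologicalSpace Metric
open scoped Topology NNReal ENNReal InnerProductSpace

namespace Summit.NavierStokesRegularity.NavierStokesRegularity.Theorems.ScenarioCensus.WhirlTop

open Literature.Analysis Literature.Analysis.FluidPDE
open Summit.NavierStokesRegularity.NavierStokesRegularity.Theorems
open Summit.NavierStokesRegularity.NavierStokesRegularity.Theses
open Summit.NavierStokesRegularity.NavierStokesRegularity.Theorems.LocalHelicityTubeDoorFrobeniusProfileRigidityHelicalSlice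
open Summit.NavierStokesRegularity.NavierStokesRegularity.Theorems.NearExtremalTransiencePerFlow.FilamentSelection
open Summit.NavierStokesRegularity.NavierStokesRegularity.Theorems.LocalSineTubeDoorProfileAlignedWindowRigidityAncient

/-! ## §6 The residual ≡ row F1 (declared); what the hypotheses admit (no smallness anywhere: streams, swirling columns with axial jets,
every exactly axisymmetric snapshot — at full speed and full swirl); summary -/

/-- The census-row threshold `whirlLevel M c_S L Θ A a` decides the row. -/
theorem whirlLevel_spec {M : ℝ} {L : E3 ≃ₗᵢ[ℝ] E3} {Θ : Set ℝ} {A a : ℝ} (hΘ : GeneratesAngles Θ) (ha : 0 < a)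
    (ν T : ℝ) (hν : 0 < ν) (hT : 0 < T) (u : ℝ → E3 → E3) (p : ℝ → E3 → ℝ)
    (hsol : IsClassicalNSSolutionOn (Ico 0 T) ν 0 u p) (hLH : IsLerayHopfOn T ν 0 (u 0) u)
    (hdec : HasRapidSpatialDecay (u 0)) (hM : OneLevelTop.HasTypeIConstant ν T M u)
    (hfreq : ∃ᶠ t in 𝓝[<] T, ∀ x ∈ TwoTimeTop.topSet ν T u SnapshotTop.snapLevel t,
      WhirlPocketAt ν T u L Θ A a (whirlLevel M SnapshotTop.snapLevel L Θ A a) t x) :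
    HasSmoothExtensionPast ν 0 u T := by
  have hp : 0 < SnapshotTop.snapLevel ∧ GeneratesAngles Θ ∧ 0 < a := ⟨SnapshotTop.snapLevel_pos, hΘ, ha⟩
  have hspec := (Classical.choose_spec (whirlFloor_holds M SnapshotTop.snapLevel L Θ A a hp.1 hp.2.1 hp.2.2)).2
    ν T hν hT u p hsol hLH hdec hM
  have hlev : whirlLevel M SnapshotTop.snapLevel L Θ A a =
      Classical.choose (whirlFloor_holds M SnapshotTop.snapLevel L Θ A a hp.1 hp.2.1 hp.2.2) := by
    unfold whirlLevel
    rw [dif_pos hp]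
  rw [hlev] at hfreq
  exact ScalingTop.row_of_floor hν hT hsol hLH hdec hspec hfreq

/-- **Residual «WHIRL COLLAPSE»** (maximal frame): every maximal Type-I Clay blow-up with constant `M` admits, for SOME frame `L`,
generating angle set `Θ`, reach `A` and radius `a > 0`, whirl pockets at the threshold `whirlLevel M c_S L Θ A a` at every `c_S`-fast point
along some `t_k ↑ T`.  DECLARED ≡ row F1 (`whirlCollapse_iff_rowF1`); no movement on `Row_F1` is claimed — after the floor its content is
«there is no Type-I Clay blow-up». -/
@[conjecture] def WhirlCollapse : Prop :=
  ∀ (ν T : ℝ), 0 < ν → 0 < T → ∀ (u : ℝ → E3 → E3) (p : ℝ → E3 → ℝ),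
    IsMaximalSmoothSolution ν 0 u p T → IsLerayHopfOn T ν 0 (u 0) u → HasRapidSpatialDecay (u 0) →
    ∀ M : ℝ, OneLevelTop.HasTypeIConstant ν T M u →
      ∃ (L : E3 ≃ₗᵢ[ℝ] E3) (Θ : Set ℝ) (A a : ℝ), GeneratesAngles Θ ∧ 0 < a ∧
        ∃ᶠ t in 𝓝[<] T, ∀ x ∈ TwoTimeTop.topSet ν T u SnapshotTop.snapLevel t,
          WhirlPocketAt ν T u L Θ A a (whirlLevel M SnapshotTop.snapLevel L Θ A a) t x

/-- **The split**: whirl row (proved) + residual ⇒ row F1 (target BY NAME). -/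
theorem rowF1_of_whirlCollapse (hR : WhirlCollapse) : ScenarioCensus.Row_F1 := by
  unfold ScenarioCensus.Row_F1
  intro ν T hν hT u p hsol hLH hdec hTI
  by_contra hext
  obtain ⟨M, hM⟩ := OneLevelTop.exists_hasTypeIConstant hν hTI
  obtain ⟨L, Θ, A, a, hΘ, ha, hfreq⟩ := hR ν T hν hT u p ⟨hsol, hext⟩ hLH hdec M hM
  exact hext (whirlLevel_spec hΘ ha ν T hν hT u p hsol hLH hdec hM hfreq)

/-- The residual is a consequence of row F1 (vacuously). -/
theorem whirlCollapse_of_rowF1 (hrow : ScenarioCensus.Row_F1) : WhirlCollapse :=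
  fun ν T hν hT u p hmax hLH hdec _ hM =>
    (hmax.2 (hrow ν T hν hT u p hmax.1 hLH hdec hM.isTypeIBlowup)).elim

/-- The residual `WhirlCollapse` is EXACTLY `Row_F1`. -/
theorem whirlCollapse_iff_rowF1 : WhirlCollapse ↔ ScenarioCensus.Row_F1 :=
  ⟨rowF1_of_whirlCollapse, whirlCollapse_of_rowF1⟩

/-! ### What the hypotheses admit (hypothesis level): NOTHING is asked to be small, slow or swirl-free.  EVERY snapshot that is exactly
axisymmetric about the axis `x + ℓ L(ℝ e₂)` in the frame `L` has whirl pockets of accuracy `0` for EVERY angle set, reach and radius — in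
particular a uniform STREAM along the axis (fast EVERYWHERE once `√(T − t)|c| ≥ Λ√ν`) and a SWIRLING COLUMN WITH AN AXIAL JET
`w ↦ α J w + β e₂` (`J w = (−w₁, w₀, 0)`: rigid rotation about the axis + jet; genuinely with swirl); the rest state too.  The content of
the floors is on the LIMIT side: the exact relations have NO non-trivial solution in `𝒦_M` (§4). -/

-- `rotZ_smul_eZ'`: the line restates the tree's `ScrewTop.rotZ_smul_eZ'`; taken BY NAME (gate lint dedup.landed).

/-- **Every exactly axisymmetric snapshot is in the cell, at ANY speed and with ANY swirl**: if `V : ℝ³ → ℝ³` is axisymmetric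
(`IsAxisymmetric V`: `V (R_θ y) = R_θ V y` for all `θ`, `y`) then the snapshot `y ↦ L V(L⁻¹(y − x))` has whirl pockets of accuracy `0`
about `x` (apex `b = 0`) for every angle set `Θ`, reach `A ≥ 0` and radius `a`. -/
theorem whirlPocketAt_of_isAxisymmetric {ν T t : ℝ} (L : E3 ≃ₗᵢ[ℝ] E3) {V : E3 → E3} (hV : IsAxisymmetric V) (x : E3)
    {Θ : Set ℝ} {A a : ℝ} (hA : 0 ≤ A) :
    WhirlPocketAt ν T (fun _ y => L (V (L.symm (y - x)))) L Θ A a 0 t x := by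
  refine ⟨0, by simpa using hA, fun θ _ w _ => ?_⟩
  have e : ∀ z : E3, L.symm ((x + Real.sqrt (ν * (T - t)) • ((0 : E3) + L z)) - x) = Real.sqrt (ν * (T - t)) • z := by
    intro z
    rw [zero_add, add_sub_cancel_left, LinearIsometryEquiv.map_smul, LinearIsometryEquiv.symm_apply_apply]
  simp only [LinearIsometryEquiv.symm_apply_apply, e]
  rw [← rotZ_smul, hV, sub_self, norm_zero, mul_zero, zero_mul]

/-- **The SWIRLING COLUMN WITH AN AXIAL JET `w ↦ α J w + β e₂` is axisymmetric** (`J = rotGen`, the infinitesimal rotation; `α ≠ 0` is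
genuine swirl): tree `rotGen_rotZ` (`J R_θ = R_θ J`). -/
theorem swirlColumn_isAxisymmetric (α β : ℝ) : IsAxisymmetric (fun w : E3 => α • rotGen w + β • eZ) := by
  intro θ w
  show α • rotGen (rotZ θ w) + β • eZ = rotZ θ (α • rotGen w + β • eZ)
  rw [rotGen_rotZ, ScrewBlowdown.rotZ_add_smul_eZ, rotZ_smul]

/-- A uniform STREAM ALONG THE WHIRL AXIS, `u(t, y) = c • L e₂`, has whirl pockets of accuracy `0` about every apex, for every angle set
and radius — at ANY speed. -/
theorem whirlPocketAt_of_stream {ν T : ℝ} (L : E3 ≃ₗᵢ[ℝ] E3) (c : ℝ) {Θ : Set ℝ} {A a t : ℝ} (hA : 0 ≤ A) (x : E3) :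
    WhirlPocketAt ν T (fun _ _ => c • L eZ) L Θ A a 0 t x := by
  refine ⟨0, by simpa using hA, fun θ _ w _ => ?_⟩
  have e1 : L.symm (c • L eZ) = c • eZ := by
    rw [LinearIsometryEquiv.map_smul, LinearIsometryEquiv.symm_apply_apply]
  rw [e1, ScrewTop.rotZ_smul_eZ', sub_self, norm_zero, mul_zero, zero_mul]

-- `stream_fast`: the line restates the tree's `ScrewTop.stream_fast`; taken BY NAME (gate lint dedup.landed).

/-- A STEADY STREAM ALONG A DIRECTION FIXED BY `L`, `u(t, y) = c • d'` with `L d' = d'`, has precession pockets of accuracy `0` for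
`(L, d, θ)` about every apex, for EVERY offset `d` and lag `θ` — at ANY speed. -/
theorem precessionPocketAt_of_stream {ν T : ℝ} (L : E3 ≃ₗᵢ[ℝ] E3) {d' : E3} (hfix : L d' = d') (c : ℝ) (d : E3) {θ A a t : ℝ}
    (hA : 0 ≤ A) (x : E3) : PrecessionPocketAt ν T (fun _ _ => c • d') L d θ A a 0 t x := by
  refine ⟨0, by simpa using hA, fun w _ => ?_⟩
  rw [LinearIsometryEquiv.map_smul, hfix, sub_self, norm_zero, mul_zero, zero_mul]

/-- The rest state has both read-outs with accuracy `0` (and an empty top). -/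
theorem pockets_rest {ν T : ℝ} (L : E3 ≃ₗᵢ[ℝ] E3) (d : E3) {Θ : Set ℝ} {θ A a t : ℝ} (hA : 0 ≤ A) (x : E3) :
    WhirlPocketAt ν T (fun _ _ => 0) L Θ A a 0 t x ∧ PrecessionPocketAt ν T (fun _ _ => 0) L d θ A a 0 t x := by
  refine ⟨⟨0, by simpa using hA, fun θ' _ w _ => ?_⟩, ⟨0, by simpa using hA, fun w _ => ?_⟩⟩
  · rw [LinearIsometryEquiv.map_zero, show rotZ θ' (0 : E3) = 0 from (ScrewTop.rotLin θ').map_zero, sub_self, norm_zero, mul_zero, zero_mul]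
  · rw [LinearIsometryEquiv.map_zero, sub_self, norm_zero, mul_zero, zero_mul]

/-- Monotonicity of the whirl read-out in the threshold and ANTItonicity in the angle set. -/
theorem whirlPocketAt_mono {ν T : ℝ} {u : ℝ → E3 → E3} {L : E3 ≃ₗᵢ[ℝ] E3} {Θ Θ' : Set ℝ} {A a ε ε' t : ℝ} {x : E3} (hle : ε ≤ ε')
    (hsub : Θ' ⊆ Θ) (hν : 0 ≤ Real.sqrt ν) (hP : WhirlPocketAt ν T u L Θ A a ε t x) : WhirlPocketAt ν T u L Θ' A a ε' t x := by
  obtain ⟨b, hb, hp⟩ := hP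
  exact ⟨b, hb, fun θ hθ w hw => (hp θ (hsub hθ) w hw).trans (mul_le_mul_of_nonneg_right hle hν)⟩

/-- LINE 41's helical read-out at PITCH `0` over `[θ₁, θ₂]` IS the whirl read-out over `Icc θ₁ θ₂` (definitional, `0 • e₂ = 0`): the cell
LINE 41 declared open is this line's row WX. -/
theorem whirlPocketAt_iff_pitch_zero {ν T : ℝ} {u : ℝ → E3 → E3} {L : E3 ≃ₗᵢ[ℝ] E3} {θ₁ θ₂ A a ε t : ℝ} {x : E3} :
    WhirlPocketAt ν T u L (Icc θ₁ θ₂) A a ε t x ↔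
      ∃ b : E3, ‖b‖ ≤ A ∧ ∀ θ ∈ Icc θ₁ θ₂, ∀ w : E3, ‖w‖ ≤ a →
        Real.sqrt (T - t) * ‖L.symm (u t (x + (Real.sqrt (ν * (T - t))) • (b + L (rotZ θ w + ((0 : ℝ) * θ) • eZ))))
          - rotZ θ (L.symm (u t (x + (Real.sqrt (ν * (T - t))) • (b + L w))))‖ ≤ ε * Real.sqrt ν := by
  simp only [WhirlPocketAt, zero_mul, zero_smul, add_zero]

/-! ## §7 Summary -/

/-- **LINE 42 «whirl-top», summary.**  In kernel, standard axioms: the two FLOORS (universal over fast points, every level `Λ`), the four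
census ROWS (generating angle set; an angle range = LINE 41's declined pitch-`0` cell; ONE irrational turn; ONE lagged isometry), and the
declared residual `WhirlCollapse ↔ Row_F1`. -/
theorem whirlTop_summary :
    WhirlFloor ∧ PrecessionFloor ∧ Row_F1gx ∧ Row_F1wx ∧ Row_F1qx ∧ Row_F1px ∧ (WhirlCollapse ↔ ScenarioCensus.Row_F1) :=
  ⟨whirlFloor_holds, precessionFloor_holds, rowF1gx_holds, rowF1wx_holds, rowF1qx_holds, rowF1px_holds, whirlCollapse_iff_rowF1⟩

end Summit.NavierStokesRegularity.NavierStokesRegularity.Theorems.ScenarioCensus.WhirlTop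

namespace Summit.NavierStokesRegularity.NavierStokesRegularity.Theorems.ScenarioCensus

/-! ## Census KEYS (ns `…Theorems.ScenarioCensus`): the WHIRL / PRECESSION members of row F1 (LINE 42) — TREE-decided F1gx / F1wx / F1qx / F1px and floors WF / PF -/

/-- **Cell F1gx — WHIRL-POCKET SNAPSHOTS over a GENERATING angle set** (Type I with constant `M` · for a frame `L` and an angle set `Θ` generating all angles, along some `t_k ↑ T` every `c_S`-fast point has an apex and a pocket on which the snapshot is `ε`-invariant under the rotations `R_θ`, `θ ∈ Θ` ⇒ smooth extension past `T`): `:= WhirlTop.Row_F1gx`. DECIDED. -/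
def Row_F1gx : Prop := WhirlTop.Row_F1gx
/-- F1gx is EXCLUDED (decided in the tree): `WhirlTop.rowF1gx_holds`. -/
theorem row_F1gx_excluded : Row_F1gx := WhirlTop.rowF1gx_holds

/-- **Cell F1wx — WHIRL pockets over an ANGLE RANGE `[θ₁, θ₂]`** (LINE 41's declined pitch-`0` cell): `:= WhirlTop.Row_F1wx`. DECIDED. -/
def Row_F1wx : Prop := WhirlTop.Row_F1wx
/-- F1wx is EXCLUDED (decided in the tree): `WhirlTop.rowF1wx_holds`. -/
theorem row_F1wx_excluded : Row_F1wx := WhirlTop.rowF1wx_holds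

/-- **Cell F1qx — ONE IRRATIONAL TURN** (`ε`-invariance under a single rotation by an irrational multiple of `2π`): `:= WhirlTop.Row_F1qx`. DECIDED. -/
def Row_F1qx : Prop := WhirlTop.Row_F1qx
/-- F1qx is EXCLUDED (decided in the tree): `WhirlTop.rowF1qx_holds`. -/
theorem row_F1qx_excluded : Row_F1qx := WhirlTop.rowF1qx_holds

/-- **Cell F1px — PRECESSION pockets** (the snapshot repeats itself, to accuracy `ε`, under ONE lagged isometry about an apex): `:= WhirlTop.Row_F1px`. DECIDED. -/
def Row_F1px : Prop := WhirlTop.Row_F1px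
/-- F1px is EXCLUDED (decided in the tree): `WhirlTop.rowF1px_holds`. -/
theorem row_F1px_excluded : Row_F1px := WhirlTop.rowF1px_holds

/-- **Floor WF — the WHIRL floor** (universal over fast points, every level; no maximality hypothesis): `WhirlTop.whirlFloor_holds`. -/
theorem row_F1_whirlFloor : WhirlTop.WhirlFloor := WhirlTop.whirlFloor_holds
/-- **Floor PF — the PRECESSION floor**: `WhirlTop.precessionFloor_holds`. -/
theorem row_F1_precessionFloor : WhirlTop.PrecessionFloor := WhirlTop.precessionFloor_holds

end Summit.NavierStokesRegularity.NavierStokesRegularity.Theorems.ScenarioCensus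

end
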